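import Summits.QuantumFields.BalabanUV.T4Continuum.Spine.NE1p.DressedSizeDominationBasicStep
import Literature.MathematicalPhysics.QuantumFieldTheory.Balaban1983to89.T4GenFunBounds

/-!
# T⁴ programme, spine estimate NE1′ (node O3b/H2) — the dressed term TOTALS are moment generating functions: what the
# consumer `T4MatchingAssembly.HybridNE7` reads of NE1′, and the ONE two-run binder the dressing leaves

Cell `pub-balaban-gaps` (YM blitz Y1, track G2), seat `ne1` gen 2 (prover-pub-balaban-gaps-ne1-g2-0), record `HOME/ne/NE1.md`
§4 rows R22–R26; ADDITIVE — imports the seat's gen-0 modules `DressedSizeDomination(BasicStep)` (p339197, p339692) and the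
tree's `T4GenFunBounds` (node E2) only, modifies nothing.

WHAT THIS IS.  `HybridNE7` reads the dressed runs ONLY through the real numbers `A K t τ` — the TOTAL INTEGRALS of the
dressed terms (dictionary `Z K t = Σ_τ A K t τ`).  In the cell's convention (α) (T4-DAG D5; `T4DressedR.RopIn`; gen 0 §1)
every map producing a term's value from its parent's — insertion of a characteristic function, a sharp renormalisation
transformation / fibre integration, the basic ℝ-step with UNDRESSED insert and normalisation ([Balaban1989LargeFieldI] (0.3)
p. 176, (1.100) p. 201: SHAPE only) — is not only monotone positively-homogeneous (gen 0) but positive-LINEAR in the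
integrated piece, so the total of the dressed term born from `ρ₀·e^{tF}` is a positive linear functional of the dressing on
the ORIGINAL field space: `A K t τ = ∫ e^{t F_K} dν_{K,τ} = mgf F_K ν_{K,τ} t`, `ν_{K,τ}` finite, `|F_K| ≤ B` — the MGF FORM
(`MGFForm`, §2; at birth `mgfForm_of_density`; through one ℝ-step TERMWISE on the tree's model of (0.3)
`lintegral_rop03Term_dressed`, the Fubini step of `B15.BasicStep.lintegral_rop03` / `T4DressedR.lintegral_ropIn`, with no
hypothesis on the dressing beyond measurability; along ANY chain of gen 0's value maps in the sibling module
`Spine/NE1p/DressedMGFFormChain.lean`, via Mathlib `Kernel` composition).  What the form settles, all kernel: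
* §1 [one term] `tiltedMean F ν s = ∫F d(ν.tilted (s·F))` equals `(cgf F ν)′(s)` (Mathlib `integral_tilted_mul_self`); two
  terms whose tilted means differ by `≤ η` on `|s| ≤ l₀` have `|(cgf′(t) − cgf′(0)) − (cgf(t) − cgf(0))| ≤ η|t|` there.
* §2 the form RECOVERS gen 0's size hypothesis `TermDominated l₀ e^{−l₀B} e^{l₀B}` against the undressed family `A K 0 τ`
  (`MGFForm.termDominated`) — so `weight`/`shell`/`lt_one`/`summable` transfer as there; each `t ↦ A K t τ` is the MGF of
  a variable bounded by `B`, so the «μ-UNIFORMITY» of NE1′ (ONE source radius for all `K`) is NO CONDITION at the level the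
  consumer reads; shell parts that are parts (`νsh ≤ ν`) keep the form (`MGFForm.sub`).
* §3 **THE DRESSING'S ENTIRE LOAD ON `core`** (`core_of_mgfForm`): NE7's core sandwich for the DRESSED cores with ONE
  `t`-independent constant ⇐ the same sandwich for the UNDRESSED cores (width `w K`) ∧ the displayed binder
  `TiltedMeanMatching … η` (on every good class the source-tilted, history-conditioned FIRST MOMENTS of the observable under
  the two runs agree within `η K` for all `|s| ≤ l₀`); width `w K + l₀·η K`.  `hybridNE7_of_mgfForm`: all five clauses for
  the dressed runs ⇐ undressed datum + MGF forms + `TiltedMeanMatching` (remainders `δ K + (l₀/vol)·η K`).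
* §4 [top level] `matchingModConstants_of_tiltedMeans`: node U5's output shape `MatchingModConstants` for MGF-form
  partition functions ⇐ tilted first-moment matching of the WHOLE measures (`l₀·η K ≤ vol·δ K`), no histories.
Read through its consumer, NE1′ = SIZE (gen 0) + t-STRUCTURE (here) — both kernel — + ONE two-run first-moment statement of
NE5/NE7 type in which no dressed density, no representation (2.16)–(2.18) and no source-analyticity occurs; the ≈ 90-page
dressed transposition of [B13] L1–3 / [B14] §2 / [B15] §1 / [B16] §§1–3 (record §5) is the known ROUTE to that statement.

WHAT THIS IS NOT.  Not NE1′, not `TiltedMeanMatching`: nothing is instantiated on Bałaban's densities (the run is DATA in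
`T4Continuum.FiniteEpsData`, `R` a black box beyond (0.4): even the MGF form is not derivable on the datum past one step);
spine PROVED 0∕9 unchanged; (B) 0∕13.  Rung (B)+1 bookkeeping on ONE finite four-torus — NOT infinite volume, NOT a mass
gap, NOT OS on ℝ⁴, NOT Clay.  HONEST DEPENDENCY: continuum YM on T⁴ ⇐ BetaPertH ∧ nine spine estimates (0/9 proved);
BetaPertH ⇐ (D1) ∧ (D4) ∧ CAP+tail.  Every declaration is [folklore] (Mathlib `mgf`/`cgf`/`Measure.tilted`, the mean value
inequality, order arithmetic, `lmarginal` Fubini); nothing of [Balaban1989LargeFieldI/II] is asserted.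
-/

noncomputable section

namespace Summit.QuantumFields.BalabanUV.T4Continuum.NE1p.DressedMGFForm

open MeasureTheory ProbabilityTheory Finset
open scoped ENNReal
open Literature.MathematicalPhysics.QuantumFieldTheory.Balaban1983to89
open Literature.MathematicalPhysics.QuantumFieldTheory.Balaban1983to89.T4WeightBudget
open Literature.MathematicalPhysics.QuantumFieldTheory.Balaban1983to89.T4IndicatorShell
open Literature.MathematicalPhysics.QuantumFieldTheory.Balaban1983to89.T4MatchingAssembly
open Literature.MathematicalPhysics.QuantumFieldTheory.Balaban1983to89.B15.BasicStep
open Summit.QuantumFields.BalabanUV.T4Continuum.NE1p.DressedSizeDomination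

/-! ## §1 One term: the MGF of a variable bounded by `B` under a finite measure, its tilted means, and two such terms -/

section OneTerm

variable {Ω : Type*} {mΩ : MeasurableSpace Ω}

/-- The SOURCE-TILTED MEAN of `F` under `ν` at tilt `s`: the mean of `F` under the probability measure
`e^{sF}ν / ∫e^{sF}dν` (Mathlib `Measure.tilted`; `0` if `ν = 0`). [folklore] -/
def tiltedMean (F : Ω → ℝ) (ν : Measure Ω) (s : ℝ) : ℝ :=
  ∫ ω, F ω ∂(ν.tilted fun ω => s * F ω)

variable {ν : Measure Ω} {F : Ω → ℝ} {B : ℝ}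

variable [IsFiniteMeasure ν]

/-- Under a finite measure, for a measurable `F` with `|F| ≤ B`: the tilted mean IS the derivative of the cumulant generating
function `cgf F ν = log ∘ mgf F ν` (Mathlib `integral_tilted_mul_self`). [folklore] -/
theorem deriv_cgf_eq_tiltedMean (hFm : Measurable F) (hF : ∀ ω, |F ω| ≤ B) (s : ℝ) :
    deriv (cgf F ν) s = tiltedMean F ν s :=
  (integral_tilted_mul_self
    (T4GenFunBounds.mem_interior_integrableExpSet hFm.aemeasurable (ae_of_all _ hF) s)).symm

/-- **TWO TERMS WHOSE TILTED MEANS AGREE.**  `ν` on `Ω`, `ν'` on `Ω'` finite, `F`, `F'` measurable with `|F|, |F'| ≤ B`.  If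
the tilted means differ by at most `η` for every tilt `|s| ≤ l₀`, then for `|t| ≤ l₀`
`|(cgf F' ν' t − cgf F' ν' 0) − (cgf F ν t − cgf F ν 0)| ≤ η·|t|` — the mean value inequality for
`s ↦ cgf F' ν' s − cgf F ν s`, whose derivative is the difference of the tilted means. [folklore] -/
theorem abs_cgf_sub_sub_le {Ω' : Type*} {mΩ' : MeasurableSpace Ω'} {ν' : Measure Ω'} [IsFiniteMeasure ν'] {F' : Ω' → ℝ}
    (hFm : Measurable F) (hF : ∀ ω, |F ω| ≤ B) (hFm' : Measurable F') (hF' : ∀ ω, |F' ω| ≤ B) {l₀ η : ℝ}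
    (hη : ∀ s, |s| ≤ l₀ → |tiltedMean F' ν' s - tiltedMean F ν s| ≤ η) {t : ℝ} (ht : |t| ≤ l₀) :
    |(cgf F' ν' t - cgf F' ν' 0) - (cgf F ν t - cgf F ν 0)| ≤ η * |t| := by
  have hdF := T4GenFunBounds.differentiable_cgf_of_abs_le (μ := ν) hFm.aemeasurable (ae_of_all _ hF)
  have hdF' := T4GenFunBounds.differentiable_cgf_of_abs_le (μ := ν') hFm'.aemeasurable (ae_of_all _ hF')
  have hdiff : ∀ x ∈ Set.Icc (-l₀) l₀, DifferentiableAt ℝ (fun s => cgf F' ν' s - cgf F ν s) x :=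
    fun x _ => (hdF' x).sub (hdF x)
  have hbound : ∀ x ∈ Set.Icc (-l₀) l₀, ‖deriv (fun s => cgf F' ν' s - cgf F ν s) x‖ ≤ η := by
    intro x hx
    have hx' : |x| ≤ l₀ := abs_le.mpr ⟨hx.1, hx.2⟩
    have hds : deriv (fun s => cgf F' ν' s - cgf F ν s) x = deriv (cgf F' ν') x - deriv (cgf F ν) x :=
      deriv_sub (hdF' x) (hdF x)
    rw [hds, deriv_cgf_eq_tiltedMean hFm' hF' x, deriv_cgf_eq_tiltedMean hFm hF x, Real.norm_eq_abs]
    exact hη x hx'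
  have hl₀ : 0 ≤ l₀ := (abs_nonneg t).trans ht
  have key := (convex_Icc (-l₀) l₀).norm_image_sub_le_of_norm_deriv_le hdiff hbound ⟨by linarith, hl₀⟩ (abs_le.mp ht)
  rw [Real.norm_eq_abs, Real.norm_eq_abs, sub_zero] at key
  have hrw : (cgf F' ν' t - cgf F ν t) - (cgf F' ν' 0 - cgf F ν 0)
      = (cgf F' ν' t - cgf F' ν' 0) - (cgf F ν t - cgf F ν 0) := by ring
  exact hrw ▸ key

/-- The MGF at `t` is the mass times `e^{cgf(t) − cgf(0)}` (for `ν ≠ 0`; Mathlib `exp_cgf`, `mgf_zero'`). [folklore] -/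
theorem mgf_eq_mass_mul_exp [NeZero ν] (hFm : Measurable F) (hF : ∀ ω, |F ω| ≤ B) (t : ℝ) :
    mgf F ν t = ν.real Set.univ * Real.exp (cgf F ν t - cgf F ν 0) := by
  have hint : ∀ s : ℝ, Integrable (fun ω => Real.exp (s * F ω)) ν := fun s =>
    T4GenFunBounds.integrable_exp_mul_of_bound (μ := ν) hFm.aemeasurable (ae_of_all _ hF) s
  rw [← mgf_zero', ← exp_cgf (hint 0), ← exp_cgf (hint t), ← Real.exp_add]
  congr 1
  ring

end OneTerm

/-! ## §2 The MGF form of a dressed family, what it recovers, and where it comes from -/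

section Form

variable {ι : Type*} {Ω : ℕ → Type*} [∀ K, MeasurableSpace (Ω K)]

/-- **MGF FORM** of a dressed family of term totals `A K t τ` (run with `K` steps, source `t`, class `τ ∈ T K`): on the
ORIGINAL field space `Ω K` there are ONE bounded measurable observable `F K` (the unit-scale averaged loop variable read on
the finest field, `|F K| ≤ B`) and finite measures `ν K τ` (history-conditioned parts of the Gibbs measure, `Σ_τ ν K τ = ρ₀dU`
in the application) with `A K t τ = ∫ e^{t F K} dν K τ` for every real `t`.  Forced in convention (α) by the positive-LINEARITY
of the run's value maps (births: `mgfForm_of_density`; one ℝ-step: `lintegral_rop03Term_dressed`); HYPOTHESIS SHAPE on the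
datum `T4Continuum.FiniteEpsData`. [folklore] -/
structure MGFForm (B : ℝ) (T : ℕ → Finset ι) (F : ∀ K, Ω K → ℝ) (ν : ∀ K, ι → Measure (Ω K))
    (A : ℕ → ℝ → ι → ℝ) : Prop where
  /-- the bound is a nonnegative number -/
  nonneg : 0 ≤ B
  /-- the observable is measurable … -/
  meas : ∀ K, Measurable (F K)
  /-- … and bounded by `B` everywhere -/
  bound : ∀ K ω, |F K ω| ≤ B
  /-- the history-conditioned measures are finite -/
  finite : ∀ K, ∀ τ ∈ T K, IsFiniteMeasure (ν K τ)
  /-- the dressed term total is the MGF -/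
  repr : ∀ K (t : ℝ), ∀ τ ∈ T K, A K t τ = mgf (F K) (ν K τ) t

variable {B : ℝ} {T : ℕ → Finset ι} {F : ∀ K, Ω K → ℝ} {ν : ∀ K, ι → Measure (Ω K)} {A : ℕ → ℝ → ι → ℝ}

/-- The undressed total (`t = 0`) is the mass of the history-conditioned measure. [folklore] -/
theorem MGFForm.zero_eq (h : MGFForm B T F ν A) (K : ℕ) {τ : ι} (hτ : τ ∈ T K) :
    A K 0 τ = (ν K τ).real Set.univ := by
  rw [h.repr K 0 τ hτ, mgf_zero']

/-- … in particular nonnegative. [folklore] -/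
theorem MGFForm.zero_nonneg (h : MGFForm B T F ν A) (K : ℕ) {τ : ι} (hτ : τ ∈ T K) : 0 ≤ A K 0 τ := by
  rw [h.zero_eq K hτ]; exact measureReal_nonneg

/-- Every dressed total is nonnegative. [folklore] -/
theorem MGFForm.nonneg' (h : MGFForm B T F ν A) (K : ℕ) (t : ℝ) {τ : ι} (hτ : τ ∈ T K) : 0 ≤ A K t τ := by
  rw [h.repr K t τ hτ]; exact mgf_nonneg

/-- **THE MGF FORM RECOVERS THE GEN-0 SIZE HYPOTHESIS**: termwise domination of the dressed family by the undressed family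
`A K 0 τ` with the birth constants `e^{∓ l₀ B}` on `|t| ≤ l₀` (`DressedSizeDomination.TermDominated`) — so
`relWeightBound_of_dominated`, `shellWeightBound_of_dominated`, `hybridNE7_of_dominated` of gen 0 apply. [folklore] -/
theorem MGFForm.termDominated (h : MGFForm B T F ν A) (l₀ : ℝ) :
    TermDominated l₀ (Real.exp (-(l₀ * B))) (Real.exp (l₀ * B)) T (fun K τ => A K 0 τ) A := by
  refine ⟨fun K τ hτ => h.zero_nonneg K hτ, fun K t ht τ hτ => ?_⟩
  haveI := h.finite K τ hτ
  -- node E2's two-sided bound `ν(Ω)e^{−|t|B} ≤ mgf ≤ ν(Ω)e^{|t|B}` (`T4GenFunBounds`)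
  have hlo := T4GenFunBounds.exp_neg_le_mgf_of_abs_le (μ := ν K τ) (h.meas K).aemeasurable (ae_of_all _ (h.bound K)) t
  have hhi := T4GenFunBounds.mgf_le_of_abs_le (X := F K) (μ := ν K τ) (ae_of_all _ (h.bound K)) t
  rw [mul_comm] at hlo hhi
  have hm : 0 ≤ (ν K τ).real Set.univ := measureReal_nonneg
  have htB : |t| * B ≤ l₀ * B := mul_le_mul_of_nonneg_right ht h.nonneg
  dsimp only
  rw [h.repr K t τ hτ, h.zero_eq K hτ]
  constructor
  · exact (mul_le_mul_of_nonneg_right (Real.exp_le_exp.mpr (neg_le_neg htB)) hm).trans hlo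
  · exact hhi.trans (mul_le_mul_of_nonneg_right (Real.exp_le_exp.mpr htB) hm)

/-- **SHELL PARTS THAT ARE PARTS KEEP THE FORM.**  If the shell family is the MGF over sub-measures `νsh K τ ≤ ν K τ` (a
shell part of a term is the total of a sub-family of its integrand), the cores `A − shA` are in MGF form over the
difference measures. [folklore] -/
theorem MGFForm.sub {νsh : ∀ K, ι → Measure (Ω K)} {shA : ℕ → ℝ → ι → ℝ} (h : MGFForm B T F ν A)
    (hsh : MGFForm B T F νsh shA) (hle : ∀ K, ∀ τ ∈ T K, νsh K τ ≤ ν K τ) :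
    MGFForm B T F (fun K τ => ν K τ - νsh K τ) (fun K t τ => A K t τ - shA K t τ) where
  nonneg := h.nonneg; meas := h.meas; bound := h.bound
  finite := fun K τ hτ => by
    haveI := h.finite K τ hτ
    exact isFiniteMeasure_of_le (ν K τ) Measure.sub_le
  repr := fun K t τ hτ => by
    haveI := h.finite K τ hτ
    haveI := hsh.finite K τ hτ
    haveI : IsFiniteMeasure (ν K τ - νsh K τ) := isFiniteMeasure_of_le (ν K τ) Measure.sub_le
    have hsplit : ν K τ = (ν K τ - νsh K τ) + νsh K τ := (Measure.sub_add_cancel_of_le (hle K τ hτ)).symm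
    have hint : ∀ (μ : Measure (Ω K)) [IsFiniteMeasure μ], Integrable (fun ω => Real.exp (t * F K ω)) μ :=
      fun μ _ => T4GenFunBounds.integrable_exp_mul_of_bound (h.meas K).aemeasurable (ae_of_all _ (h.bound K)) t
    show A K t τ - shA K t τ = mgf (F K) (ν K τ - νsh K τ) t
    rw [h.repr K t τ hτ, hsh.repr K t τ hτ, sub_eq_iff_eq_add]
    conv_lhs => rw [hsplit]
    exact integral_add_measure (hint _) (hint _)

/-- **WHERE THE FORM COMES FROM (births).**  A family of term totals obtained by integrating the dressed density
`w_t = e^{tF}` against measurable history weights `0 ≤ m K τ ≤ 1` under one finite reference measure `μ K` —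
`A K t τ = ∫ m K τ · e^{t F K} dμ K` (no ℝ-step yet: the histories are products of characteristic functions on the original
space) — is in MGF form with `ν K τ = (μ K).withDensity (m K τ)`. [folklore] -/
theorem mgfForm_of_density {μ : ∀ K, Measure (Ω K)} [∀ K, IsFiniteMeasure (μ K)] {m : ∀ K, ι → Ω K → ℝ≥0∞}
    (hB : 0 ≤ B) (hFm : ∀ K, Measurable (F K)) (hF : ∀ K ω, |F K ω| ≤ B) (hm : ∀ K τ, Measurable (m K τ))
    (hm1 : ∀ K τ ω, m K τ ω ≤ 1)
    (hA : ∀ K (t : ℝ), ∀ τ ∈ T K, A K t τ = ∫ ω, (m K τ ω).toReal * Real.exp (t * F K ω) ∂μ K) :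
    MGFForm B T F (fun K τ => (μ K).withDensity (m K τ)) A where
  nonneg := hB; meas := hFm; bound := hF
  finite := fun K τ _ => by
    refine isFiniteMeasure_withDensity (ne_top_of_le_ne_top (measure_ne_top (μ K) Set.univ) ?_)
    calc ∫⁻ ω, m K τ ω ∂μ K ≤ ∫⁻ _, 1 ∂μ K := lintegral_mono fun ω => hm1 K τ ω
      _ = μ K Set.univ := lintegral_one
  repr := fun K t τ hτ => by
    have hlt : ∀ᵐ ω ∂μ K, m K τ ω < ∞ := ae_of_all _ fun ω => (hm1 K τ ω).trans_lt ENNReal.one_lt_top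
    show A K t τ = ∫ ω, Real.exp (t * F K ω) ∂(μ K).withDensity (m K τ)
    rw [hA K t τ hτ, integral_withDensity_eq_integral_toReal_smul (hm K τ) hlt]
    simp only [smul_eq_mul]

/-- **WHERE THE FORM COMES FROM (one ℝ-step in convention (α), termwise).**  On the tree's model of
[Balaban1989LargeFieldI] (0.3) p. 176 (`B15.BasicStep.Rop03`; convention (α) = `T4DressedR.RopIn`; the `Z`-term as a map of
the integrated piece = gen-0 `rop03Term`): the TOTAL of the `Z`-term of `ℝ_in(ρ·w)` is `∫ ρ(Z,·)·w` — a positive LINEAR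
functional of the dressing `w`, under the undressed provisos only (insert measurable, its fibre integrals `≠ 0, ∞`) and
measurability of `w`.  With `w = e^{tF}` the right side is the MGF of `F` under the finite measure `ρ(Z,·)dV`
(`mgfForm_of_density`): the MGF form survives the ℝ-step history by history, whatever `w`'s dependence on the integrated
variables.  (Summed over `Z` this is `T4DressedR.lintegral_ropIn`; (0.3)–(0.4) p. 176 are cited for their SHAPE only.) [folklore] -/
theorem lintegral_rop03Term_dressed {κ : Type*} [DecidableEq κ] [Fintype κ] {X : κ → Type*} [∀ i, MeasurableSpace (X i)]
    (μ : ∀ i, Measure (X i)) [∀ i, SigmaFinite (μ i)] {R : Type*} (piece : R → (∀ i, X i) → ℝ≥0∞) (pp : R → R)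
    (fib : R → Finset κ) (Z : R) (w : (∀ i, X i) → ℝ≥0∞) (hZ : Measurable (piece Z)) (hZ'' : Measurable (piece (pp Z)))
    (hw : Measurable w) (h0 : ∀ x, (∫⋯∫⁻_(fib Z), piece (pp Z) ∂μ) x ≠ 0)
    (htop : ∀ x, (∫⋯∫⁻_(fib Z), piece (pp Z) ∂μ) x ≠ ∞) :
    ∫⁻ V, rop03Term μ piece pp fib Z (piece Z * w) V ∂Measure.pi μ = ∫⁻ V, piece Z V * w V ∂Measure.pi μ := by
  unfold rop03Term
  exact lintegral_eq_of_lmarginal_eq (fib Z) (measurable_rop03_term μ (fib Z) (hZ.mul hw) hZ'') (hZ.mul hw)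
    (lmarginal_ratio_term (fib Z) hZ'' h0 htop)

end Form

/-! ## §3 The dressing's load on `core`: tilted first-moment matching of the two runs, history by history -/

section Core

variable {ι : Type*} [DecidableEq ι] {Ω Ω' : ℕ → Type*} [∀ K, MeasurableSpace (Ω K)] [∀ K, MeasurableSpace (Ω' K)]
  {l₀ vol B : ℝ} {T : ℕ → Finset ι} {Bad : ℕ → ℝ → Finset ι}
  {F : ∀ K, Ω K → ℝ} {ν : ∀ K, ι → Measure (Ω K)} {F' : ∀ K, Ω' K → ℝ} {ν' : ∀ K, ι → Measure (Ω' K)}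

/-- **THE ONE TWO-RUN BINDER THE DRESSING LEAVES** (NOT PRINTED; hypothesis shape).  For every number of steps `K`, every
source `|t| ≤ l₀`, every class `τ` good at `t`, and every tilt `|s| ≤ l₀`: the source-tilted, history-conditioned FIRST
MOMENTS of the observable under run A (`F K`, `ν K τ` on `Ω K`) and under run B (`F' K`, `ν' K τ` on `Ω' K`, partially
summed into run A's classes) agree within `η K`.  A statement of NE5/NE7 type about first moments of ONE bounded observable;
no dressed density, no representation and no source-analyticity occurs in it. -/
def TiltedMeanMatching (l₀ : ℝ) (T : ℕ → Finset ι) (Bad : ℕ → ℝ → Finset ι) (F : ∀ K, Ω K → ℝ)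
    (ν : ∀ K, ι → Measure (Ω K)) (F' : ∀ K, Ω' K → ℝ) (ν' : ∀ K, ι → Measure (Ω' K)) (η : ℕ → ℝ) : Prop :=
  ∀ K (t : ℝ), |t| ≤ l₀ → ∀ τ ∈ T K \ Bad K t, ∀ s : ℝ, |s| ≤ l₀ →
    |tiltedMean (F' K) (ν' K τ) s - tiltedMean (F K) (ν K τ) s| ≤ η K

/-- **`core` FOR THE DRESSED CORES ⇐ `core` FOR THE UNDRESSED CORES + TILTED FIRST-MOMENT MATCHING.**  Two families of
cores `P` (run A) and `Q` (run B) in MGF form; the undressed (`t = 0`) cores sandwiched on the good classes with ONE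
constant `c_K` and width `w K`; tilted means matched within `η K`; then the dressed cores are sandwiched with the SAME
constant `c_K` and any width `≥ w K + l₀·η K`, here `vol·δ K` — `HybridNE7.core`'s literal clause. [folklore] -/
theorem core_of_mgfForm {P Q : ℕ → ℝ → ι → ℝ} {w η δ : ℕ → ℝ} (hP : MGFForm B T F ν P) (hQ : MGFForm B T F' ν' Q)
    (h0 : ∀ K : ℕ, ∃ c : ℝ, ∀ t : ℝ, |t| ≤ l₀ → ∀ τ ∈ T K \ Bad K t,
      Real.exp (c - w K) * P K 0 τ ≤ Q K 0 τ ∧ Q K 0 τ ≤ Real.exp (c + w K) * P K 0 τ)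
    (hη : TiltedMeanMatching l₀ T Bad F ν F' ν' η) (hw : ∀ K, w K + l₀ * η K ≤ vol * δ K) :
    ∀ K : ℕ, ∃ c : ℝ, ∀ t : ℝ, |t| ≤ l₀ → ∀ τ ∈ T K \ Bad K t,
      Real.exp (c - vol * δ K) * P K t τ ≤ Q K t τ ∧ Q K t τ ≤ Real.exp (c + vol * δ K) * P K t τ := by
  intro K
  obtain ⟨c, hc⟩ := h0 K
  refine ⟨c, fun t ht τ hτ => ?_⟩
  have hτT : τ ∈ T K := (Finset.mem_sdiff.mp hτ).1
  obtain ⟨hlo0, hhi0⟩ := hc t ht τ hτ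
  haveI := hP.finite K τ hτT; haveI := hQ.finite K τ hτT
  have hPt := hP.repr K t τ hτT; have hQt := hQ.repr K t τ hτT
  have hP0 := hP.zero_eq K hτT; have hQ0 := hQ.zero_eq K hτT
  have hwK : w K + l₀ * η K ≤ vol * δ K := hw K
  rcases eq_zero_or_neZero (ν K τ) with hν | hν
  · -- run A's class carries no mass ⇒ neither does run B's: both dressed cores vanish
    have hP0' : P K 0 τ = 0 := by rw [hP0, hν]; simp
    have hQ0' : Q K 0 τ = 0 := le_antisymm (by simpa [hP0'] using hhi0) (hQ.zero_nonneg K hτT)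
    have hν'0 : ν' K τ = 0 := by
      rw [← Measure.measure_univ_eq_zero, ← measureReal_eq_zero_iff (measure_ne_top _ _), ← hQ0]; exact hQ0'
    have hPt0 : P K t τ = 0 := by rw [hPt, hν]; simp
    have hQt0 : Q K t τ = 0 := by rw [hQt, hν'0]; simp
    rw [hPt0, hQt0]; simp
  have hP0pos : 0 < P K 0 τ :=
    hP0 ▸ ENNReal.toReal_pos (Measure.measure_univ_ne_zero.mpr (NeZero.ne _)) (measure_ne_top _ _)
  have hQ0pos : 0 < Q K 0 τ := lt_of_lt_of_le (mul_pos (Real.exp_pos _) hP0pos) hlo0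
  haveI : NeZero (ν' K τ) := ⟨fun h => by rw [hQ0, h] at hQ0pos; simp at hQ0pos⟩
  -- dressed = undressed · e^{cgf(t) − cgf(0)} for both runs; the tilted means agree ⇒ |gQ − gP| ≤ η|t| ≤ l₀η
  set gP := cgf (F K) (ν K τ) t - cgf (F K) (ν K τ) 0 with hgP
  set gQ := cgf (F' K) (ν' K τ) t - cgf (F' K) (ν' K τ) 0 with hgQ
  have hPfac : P K t τ = P K 0 τ * Real.exp gP := by rw [hPt, hP0]; exact mgf_eq_mass_mul_exp (hP.meas K) (hP.bound K) t
  have hQfac : Q K t τ = Q K 0 τ * Real.exp gQ := by rw [hQt, hQ0]; exact mgf_eq_mass_mul_exp (hQ.meas K) (hQ.bound K) t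
  have hg : |gQ - gP| ≤ η K * |t| :=
    abs_cgf_sub_sub_le (hP.meas K) (hP.bound K) (hQ.meas K) (hQ.bound K) (fun s hs => hη K t ht τ hτ s hs) ht
  have hη0 : 0 ≤ η K := (abs_nonneg _).trans (hη K t ht τ hτ 0 (by simpa using (abs_nonneg t).trans ht))
  have hg' : |gQ - gP| ≤ l₀ * η K := hg.trans ((mul_comm _ _).le.trans (mul_le_mul_of_nonneg_right ht hη0))
  obtain ⟨hg1, hg2⟩ := abs_le.mp hg'
  rw [hPfac, hQfac]
  constructor
  · calc Real.exp (c - vol * δ K) * (P K 0 τ * Real.exp gP)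
        = (Real.exp (c - vol * δ K) * Real.exp gP) * P K 0 τ := by ring
      _ ≤ (Real.exp (c - w K) * Real.exp gQ) * P K 0 τ := by
          refine mul_le_mul_of_nonneg_right ?_ hP0pos.le
          rw [← Real.exp_add, ← Real.exp_add, Real.exp_le_exp]; linarith
      _ = (Real.exp (c - w K) * P K 0 τ) * Real.exp gQ := by ring
      _ ≤ Q K 0 τ * Real.exp gQ := mul_le_mul_of_nonneg_right hlo0 (Real.exp_pos _).le
  · calc Q K 0 τ * Real.exp gQ ≤ (Real.exp (c + w K) * P K 0 τ) * Real.exp gQ :=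
          mul_le_mul_of_nonneg_right hhi0 (Real.exp_pos _).le
      _ = (Real.exp (c + w K) * Real.exp gQ) * P K 0 τ := by ring
      _ ≤ (Real.exp (c + vol * δ K) * Real.exp gP) * P K 0 τ := by
          refine mul_le_mul_of_nonneg_right ?_ hP0pos.le
          rw [← Real.exp_add, ← Real.exp_add, Real.exp_le_exp]; linarith
      _ = Real.exp (c + vol * δ K) * (P K 0 τ * Real.exp gP) := by ring

/-- `e^{l₀B}/e^{−l₀B} = e^{2l₀B}`: the gen-0 ratio `M/m` of the birth constants. [folklore] -/
theorem exp_div_exp_neg (l₀ B : ℝ) : Real.exp (l₀ * B) / Real.exp (-(l₀ * B)) = Real.exp (2 * l₀ * B) := by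
  rw [← Real.exp_sub]; congr 1; ring

/-- **OF `HybridNE7`'S FIVE CLAUSES THE DRESSING LEAVES ONE BINDER, `TiltedMeanMatching`.**  Given the hybrid-NE7 datum of the
UNDRESSED runs (the `t = 0` families), MGF forms for both runs' dressed families and for their shell parts over sub-measures
(a shell part is a part), the room `e^{2l₀B}(W₀ K + Wsh₀ K) < 1` of gen 0, and the tilted first-moment matching of the cores
with a summable `η`: the dressed runs carry a hybrid-NE7 datum — weights `× e^{2l₀B}`, same bad classes, remainders
`δ K + (l₀/vol)·η K`.  The dictionary and positivity (`HybridNE7.cauchy`'s other inputs) are untouched. [folklore] -/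
theorem hybridNE7_of_mgfForm {νsh : ∀ K, ι → Measure (Ω K)} {νsh' : ∀ K, ι → Measure (Ω' K)}
    {A Bf shA shB : ℕ → ℝ → ι → ℝ} {W₀ Wsh₀ δ η : ℕ → ℝ} (hvol : 0 < vol) (hl₀ : 0 ≤ l₀)
    (hA : MGFForm B T F ν A) (hB : MGFForm B T F' ν' Bf) (hshA : MGFForm B T F νsh shA) (hshB : MGFForm B T F' νsh' shB)
    (hleA : ∀ K, ∀ τ ∈ T K, νsh K τ ≤ ν K τ) (hleB : ∀ K, ∀ τ ∈ T K, νsh' K τ ≤ ν' K τ)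
    (h₀ : HybridNE7 l₀ vol T (fun K _ τ => A K 0 τ) (fun K _ τ => Bf K 0 τ) Bad W₀ (fun K _ τ => shA K 0 τ)
      (fun K _ τ => shB K 0 τ) Wsh₀ δ)
    (hroom : ∀ K, Real.exp (2 * l₀ * B) * (W₀ K + Wsh₀ K) < 1)
    (hη : TiltedMeanMatching l₀ T Bad F (fun K τ => ν K τ - νsh K τ) F' (fun K τ => ν' K τ - νsh' K τ) η)
    (hηs : Summable η) :
    HybridNE7 l₀ vol T A Bf Bad (fun K => Real.exp (2 * l₀ * B) * W₀ K) shA shB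
      (fun K => Real.exp (2 * l₀ * B) * Wsh₀ K) (fun K => δ K + l₀ / vol * η K) := by
  have hm : 0 < Real.exp (-(l₀ * B)) := Real.exp_pos _
  have hmM : Real.exp (-(l₀ * B)) ≤ Real.exp (l₀ * B) := Real.exp_le_exp.mpr (by nlinarith [hA.nonneg])
  have hratio := exp_div_exp_neg l₀ B
  have hdA := hA.termDominated l₀; have hdB := hB.termDominated l₀
  have hdshA := hshA.termDominated l₀; have hdshB := hshB.termDominated l₀
  -- sh ≤ term for the dressed families (a sub-measure's MGF is the smaller one); the room in gen-0 currency
  have hleA' : ∀ K t, |t| ≤ l₀ → ∀ τ ∈ T K, shA K t τ ≤ A K t τ := fun K t _ τ hτ => by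
    have h := (hA.sub hshA hleA).nonneg' K t hτ; linarith
  have hleB' : ∀ K t, |t| ≤ l₀ → ∀ τ ∈ T K, shB K t τ ≤ Bf K t τ := fun K t _ τ hτ => by
    have h := (hB.sub hshB hleB).nonneg' K t hτ; linarith
  have hroom' : ∀ K, Real.exp (l₀ * B) / Real.exp (-(l₀ * B)) * (W₀ K + Wsh₀ K) < 1 := fun K => hratio ▸ hroom K
  have hW : RelWeightBound l₀ T A Bf Bad (fun K => Real.exp (2 * l₀ * B) * W₀ K) := by
    rw [← hratio]
    refine relWeightBound_of_dominated (A₀ := fun K τ => A K 0 τ) (B₀ := fun K τ => Bf K 0 τ) hm hmM h₀.weight hdA hdB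
      fun K => ?_
    have := hroom' K; have := mul_nonneg (div_nonneg (hm.le.trans hmM) hm.le) (h₀.shell.nonneg K); nlinarith
  have hSh : ShellWeightBound l₀ T A Bf shA shB (fun K => Real.exp (2 * l₀ * B) * Wsh₀ K) := by
    rw [← hratio]
    exact shellWeightBound_of_dominated (A₀ := fun K τ => A K 0 τ) (B₀ := fun K τ => Bf K 0 τ)
      (shA₀ := fun K τ => shA K 0 τ) (shB₀ := fun K τ => shB K 0 τ) hm hmM h₀.shell hdA hdB hdshA hdshB hleA' hleB'
  have hw : ∀ K, vol * δ K + l₀ * η K ≤ vol * (δ K + l₀ / vol * η K) := fun K => by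
    rw [mul_add, ← mul_assoc, mul_div_cancel₀ l₀ hvol.ne']
  exact
    { weight := hW, shell := hSh, lt_one := fun K => by have := hroom K; nlinarith
      summable := h₀.summable.add (hηs.mul_left (l₀ / vol))
      core := core_of_mgfForm (hA.sub hshA hleA) (hB.sub hshB hleB) h₀.core hη hw }

end Core

/-! ## §4 Top level, no histories: node U5's output shape from tilted first moments of the whole partition functions -/

section Top

open Literature.MathematicalPhysics.QuantumFieldTheory.Balaban1983to89.T4CauchySum
/-- **`MatchingModConstants` ⇐ TILTED FIRST-MOMENT MATCHING OF THE WHOLE DRESSED PARTITION FUNCTIONS** (record R24).  If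
`Z K t = mgf (F K) (μ K) t` for finite measures `μ K` (a scheme's dressed partition functions,
`T4GenFunBounds.dressedZ_eq_partitionFn_mul_mgf`) and the source-tilted means of `F (K+1)` under `μ (K+1)` and of `F K` under
`μ K` agree within `η K` on `|s| ≤ l₀`, then node U5's output shape `T4CauchySum.MatchingModConstants vol l₀ δ Z` holds with
`c_K = log Z_{K+1}(0) − log Z_K(0)` whenever `l₀·η K ≤ vol·δ K`: in generating-function currency the T⁴ target asks for the
summable-rate convergence of FIRST moments under every bounded unit-scale tilt `|s| ≤ l₀` — nothing else. [folklore] -/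
theorem matchingModConstants_of_tiltedMeans {Ω : ℕ → Type*} [∀ K, MeasurableSpace (Ω K)] {μ : ∀ K, Measure (Ω K)}
    [∀ K, IsFiniteMeasure (μ K)] {F : ∀ K, Ω K → ℝ} {B l₀ vol : ℝ} {η δ : ℕ → ℝ} {Z : ℕ → ℝ → ℝ}
    (hFm : ∀ K, Measurable (F K)) (hF : ∀ K ω, |F K ω| ≤ B) (hZ : ∀ K t, Z K t = mgf (F K) (μ K) t)
    (hη : ∀ K s, |s| ≤ l₀ → |tiltedMean (F (K + 1)) (μ (K + 1)) s - tiltedMean (F K) (μ K) s| ≤ η K)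
    (hw : ∀ K, l₀ * η K ≤ vol * δ K) : MatchingModConstants vol l₀ δ Z := by
  intro K
  refine ⟨Real.log (Z (K + 1) 0) - Real.log (Z K 0), fun t ht => ?_⟩
  have hlog : ∀ K t, Real.log (Z K t) = cgf (F K) (μ K) t := fun K t => by rw [hZ K t, cgf]
  have h := abs_cgf_sub_sub_le (ν := μ K) (ν' := μ (K + 1)) (hFm K) (hF K) (hFm (K + 1)) (hF (K + 1))
    (fun s hs => hη K s hs) ht
  have hη0 : 0 ≤ η K := (abs_nonneg _).trans (hη K 0 (by simpa using (abs_nonneg t).trans ht))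
  rw [hlog, hlog, hlog, hlog]
  calc |cgf (F (K + 1)) (μ (K + 1)) t - cgf (F K) (μ K) t - (cgf (F (K + 1)) (μ (K + 1)) 0 - cgf (F K) (μ K) 0)|
      = |(cgf (F (K + 1)) (μ (K + 1)) t - cgf (F (K + 1)) (μ (K + 1)) 0) - (cgf (F K) (μ K) t - cgf (F K) (μ K) 0)| := by
        ring_nf
    _ ≤ η K * |t| := h
    _ ≤ η K * l₀ := mul_le_mul_of_nonneg_left ht hη0
    _ ≤ vol * δ K := by rw [mul_comm]; exact hw K

end Top
end Summit.QuantumFields.BalabanUV.T4Continuum.NE1p.DressedMGFForm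
end
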